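/-
Copyright: cell pub-balaban-gaps (YM BLITZ Y1, track G1), seat g1-p2 GEN 8 (unit `pub-balaban-gaps-g1-p2`).  Row (D4) NODE O,
JUNCTION J-3 (multi-level), ANALYTIC HALF: a block majorant `F(y)·e^{−δ·d_T(y,y′)}` on [4]'s multiscale geometry `geomT D` of a
nested family of domains of the torus (the currency of the lit-balaban lineage's HYPOTHESIS-FREE multi-level [4] Prop. 2.2,
`B6Prop22MultiLevelTorus.prop22_first_multiLevelTorus` ∕ `B6Prop22DerivMultiLevelTorus.prop22_second_multiLevelTorus`) IS a block
letter of the (D4) currency between TOP cubes, `‖T‖_{Y,Y′} ≤ (sup F)·c₁·e^{−(δ/2(d+1))·d₁(Y,Y′)}` — k-UNIFORMLY, the count of the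
`L^{(d+1)(k−j)}` level-`j` blocks inside a top cube being paid by [4] Lemma 2.1 (2.61) (`Σ_{y′} e^{−½δ·d_T(y,y′)} ≤ c₁`), NOT by a
power of `L^k`; consequence: the GENUINE multi-level flat propagator `G′ = Δ′_a^{−1}` of [4] and its η-gradient carry VALUE and
DERIVATIVE letters in the (D4) block currency with constants uniform in `k`, the torus and the family `{Ω_j}`.
HONEST FRAMING: bookkeeping over the lineage's kernel theorems; the operator is the tree's scalar model (`m² = 0`, levels `1…k`,
`Ω₁ = T_η`); nothing of Bałaban's `V′(A)` ∕ multi-level covariant objects constructed; (D4) NOT discharged (instance 0∕1); NOT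
BetaPertH, NOT continuum, NOT Clay.
-/
import Summits.QuantumFields.BalabanUV.Gaps.D4WalkBlockMultiLevelGeometry
import Literature.MathematicalPhysics.QuantumFieldTheory.Balaban1983to89.B6Prop22DerivMultiLevelTorus

/-!
# `Gaps.D4WalkBlockFlatLettersMultiLevel` — junction J-3 (multi-level), analysis: block majorants on [4]'s multiscale geometry
# are k-uniform block letters of the (D4) cube currency; the genuine multi-level flat propagator's value and derivative letters
# (cell pub-balaban-gaps, seat g1-p2 gen 8)

HONEST DEPENDENCY (cell pub-balaban, verbatim): continuum YM on T⁴ ⇐ BetaPertH ∧ nine spine estimates (0/9 proved);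
BetaPertH ⇐ (D1) ∧ (D4) ∧ CAP+tail.

[4] p. 224: «T_η ⊃ Ω₁ ⊃ Ω₂ ⊃ … ⊃ Ω_k (we admit the case when some domains Ω_j are equal to T_η)»; Prop. 2.2 (2.67) p. 234:
«|(G′λ)(x)|, … ≤ O(1)[(L^jη)², …]·e^{−½δ₀d(y,y′)}|λ|, x ∈ B^j(y), y ∈ Λ_j, supp λ ⊂ B^{j′}(y′), y′ ∈ Λ_{j′}»; Lemma 2.1 (2.61)
p. 234: «sup_{y∈𝔅} Σ_{y′∈𝔅} e^{−αδ₀d(y,y′)} ≤ c₁(α)».  [B9] Thm 3.10 (3.108) p. 416 consumes such bounds as ℓ^∞ → ℓ^∞ OPERATOR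
norms between blocks.  The seat's (D4) currency (`D4WalkBlock.blockNorm`, files 33–66) is written over the cube torus `UT Kc` of the
TOP blocks with the ℓ¹ distance `tdist1`; `D4WalkBlockMultiLevelGeometry` nests the multi-level blocks `𝔅` into the top cubes
(`topOf`, `cubeML`, `topOf_blkOf`) with `d₁ ≤ (d+1)·d_T` (`exp_neg_dist_le`).  THIS FILE:
* §1 `rowBlockMass_le_of_hasMajorant` — «supp λ ⊂ B^{j′}(y′) … ·|λ|» read as a row mass: a `B6RandomWalk.HasMajorant K` for
  `Matrix.toLin' T` w.r.t. `blkOf` bounds `Σ_{x′ ∈ B(t)} |T x x′| ≤ K(y(x), t)` (test function = sign pattern of the row on the block;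
  cf. `B9Thm37GlueQ.rowBlockSum_le_of_hasMajorant` for abstract endomorphisms);
* §2 `rowSum_le_of_hasMajorant` (row form, for weighted letters) and **`blockNorm_le_of_hasMajorant`** — THE JUNCTION: `HasMajorant (F(y)·e^{−δd_T})` + `F ≤ F̄` + (2.61) at the rate `½δ`
  with constant `c₁` ⟹ for all top cubes `‖T.map ofReal‖_{Y,Y′} ≤ F̄·c₁·e^{−(½δ/(d+1))·d₁(Y,Y′)}`: the row mass over the top
  cube `Y′` is the sum over the blocks `t ⊂ Y′` (`Finset.sum_fiberwise_of_maps_to` along `blkOf`, nesting `topOf_blkOf`) of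
  §1's block masses `≤ F(y)e^{−δd_T(y,t)} = F(y)e^{−½δd_T}·e^{−½δd_T}`, the first factor `≤ e^{−(½δ/(d+1))d₁(Y,Y′)}` for EVERY
  `t ⊂ Y′` (geometry), the second summed over ALL of `𝔅` by (2.61) — NO count of blocks per cube, hence no `L^{(d+1)(k−j)}`;
* §3 **`flatLetters_multiLevelTorus`** — the instance: ∃ `δ₁, C, M₀ > 0`, `N₀ ≥ 1` (functions of `d, ℓ` and the weight windows
  ONLY) such that for EVERY `k`, `M_h ≥ 3` with `L·M_h ≥ M₀`, `R ≥ 2L` with `R·M ≥ N₀ + 1`, torus size `P` (`P_μ ≥ 4`), nested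
  family `D : TDomains d ℓ Mh k P R`, weights in the windows with `a_{i+1} = aNext ℓ a_i c_i`, and cube torus `UT Kc` with
  `N₀_μ = L^k·Kc_μ`: for ALL top cubes `Y, Y′`, `‖G′.map ofReal‖_{Y,Y′} ≤ C·L^{2k}·e^{−δ₁d₁(Y,Y′)}` and, for every axis `μ`,
  `‖(∂_μG′).map ofReal‖_{Y,Y′} ≤ C·L^{k}·e^{−δ₁d₁(Y,Y′)}` (`G′ = gmlT`, `∂_μ = dT μ`, lattice units; in print's units
  `η = L^{−k}` these are `‖η²G′‖ ≤ Ce^{−δ₁d₁}` and `‖∇^η_μ(η²G′)‖ = ‖η·∂_μG′‖ ≤ Ce^{−δ₁d₁}` — see the sequel) — the VALUE letter and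
  the DERIVATIVE letter of `D4WalkBlockDerivative`, relative factor `1`, constants uniform in `k`, the torus AND the family `{Ω_j}` —
  inputs: `prop22_first_multiLevelTorus`, `prop22_second_multiLevelTorus` (hypothesis-free), `B6Geom246MultiLevelTorus.lemma21_torus`
  ((2.61) on the torus), §2;
* the sequel `D4WalkBlockFlatMultiLevel` rescales to print's units (`η²G′`, `η⁻¹∂`) and runs [B9] Cor. 3.5's step at `U = 1` on the
  one-term expansion of `η²G′` (57a's `blockWalkExpansion_const` + 55's `blockWalkExpansion_perturb_of_derivLetters`).
WHAT IT IS NOT.  The Hölder ∕ Laplacian ∕ adjoint entries of (2.67) (lineage files `B6Prop22{Holder,Lap,Adj}MultiLevelTorus` — same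
junction, not instantiated here); the s-decorated ∕ domain-restricted operators `G′(□)`; Bałaban's covariant multi-level objects; a
multi-level WALK geometry (the (D4) currency stays on the top cube torus: a multi-level block majorant is READ there, finer blocks
are summed, never resolved); (D4) instance 0∕1; words of row (D4) UNCHANGED.

References: T. Bałaban, Comm. Math. Phys. **96** (1984) 223–250 [4], Prop. 2.2 (2.67) p. 234, Lemma 2.1 (2.59)–(2.61) pp. 233–234,
(2.45)–(2.46) p. 231, p. 224; Comm. Math. Phys. **99** (1985) 389–434 [B9], Thm 3.10 (3.108) p. 416, Thm 3.1 (3.42) p. 397, p. 399.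
-/

noncomputable section

namespace Summit.QuantumFields.BalabanUV.Gaps.D4WalkBlockFlatLettersMultiLevel

open Finset Metric
open scoped Matrix
open Literature.MathematicalPhysics.QuantumFieldTheory.Balaban1983to89
open Literature.MathematicalPhysics.QuantumFieldTheory.Balaban1983to89.B4Reflection242 (boxDom mem_boxDom blk)
open Literature.MathematicalPhysics.QuantumFieldTheory.Balaban1983to89.B9Thm37GlueTorus (tdist1 tdist1_nonneg)
open Literature.MathematicalPhysics.QuantumFieldTheory.Balaban1983to89.TreeLengthTorus (TPt)
open Literature.MathematicalPhysics.QuantumFieldTheory.Balaban1983to89.B5TorusCover (UT)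
open Literature.MathematicalPhysics.QuantumFieldTheory.Balaban1983to89.B6MultiLevelBoxOperator (N0 Domains)
open Literature.MathematicalPhysics.QuantumFieldTheory.Balaban1983to89.B6MultiLevelTorusOperator (TDomains gmlT)
open Literature.MathematicalPhysics.QuantumFieldTheory.Balaban1983to89.B6Geom246MultiLevelBox (bset blkOf blkOf_val
  exists_blkOf_eq scale_bounds)
open Literature.MathematicalPhysics.QuantumFieldTheory.Balaban1983to89.B6Geom246MultiLevelTorus (geomT lemma21_torus
  triangle_refl_nonneg_T)
open Literature.MathematicalPhysics.QuantumFieldTheory.Balaban1983to89.B6RandomWalk (HasMajorant BlockSupp hasMajorant_mono)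
open Literature.MathematicalPhysics.QuantumFieldTheory.Balaban1983to89.B6Lemma21Repaired (Ineq261With)
open Literature.MathematicalPhysics.QuantumFieldTheory.Balaban1983to89.B6Ineq261LevelGap (K261 K261_nonneg theta_lt_one_of_log)
open Literature.MathematicalPhysics.QuantumFieldTheory.Balaban1983to89.B6Ineq243TwoLevelBox (aNext)
open Literature.MathematicalPhysics.QuantumFieldTheory.Balaban1983to89.B6Prop22MultiLevelTorus (prop22_first_multiLevelTorus)
open Literature.MathematicalPhysics.QuantumFieldTheory.Balaban1983to89.B6Prop22DerivMultiLevelTorus (dT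
  prop22_second_multiLevelTorus)
open Summit.QuantumFields.BalabanUV.Gaps.D4WalkBlock (rowMass blockNorm blockNorm_nonneg blockNorm_le_of_rowMass_le
  blockNorm_smul_le BlockWalkExpansion)
open Summit.QuantumFields.BalabanUV.Gaps.D4WalkBlockFlatLetters (rowMass_map_ofReal blockNorm_map_ofReal_le
  blockWalkExpansion_const)
open Summit.QuantumFields.BalabanUV.Gaps.D4WalkBlockMultiLevelGeometry (cubeML topOf topOf_blkOf exp_neg_dist_le)

variable {d : ℕ}

/-! ## §1. A block majorant bounds the row mass inside each block -/

section RowMass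

variable {ℓ Mh k R : ℕ} {P : Fin (d + 1) → ℕ} (D : TDomains d ℓ Mh k P R)

/-- **A block majorant bounds the row mass inside each block**: «|(Tλ)(x)| ≤ K(y,y′)|λ|, x ∈ B(y), supp λ ⊂ B(y′)» gives
`Σ_{x′ ∈ B(t)} |T x x′| ≤ K(y(x), t)` — test `T` against the sign pattern of the row `x` restricted to the block `t` (`|λ| ≤ 1`).
[cite: Balaban1984PropagatorsII, (2.51) p.232, (2.67) p.234] -/
theorem rowBlockMass_le_of_hasMajorant (T : Matrix ↥(boxDom (N0 ℓ Mh k P)) ↥(boxDom (N0 ℓ Mh k P)) ℝ)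
    {K : ↥(bset D.toDomains) → ↥(bset D.toDomains) → ℝ}
    (hT : HasMajorant (g := geomT D) (blkOf D.toDomains) (Matrix.toLin' T) K)
    (x : ↥(boxDom (N0 ℓ Mh k P))) (t : ↥(bset D.toDomains)) :
    ∑ x' ∈ Finset.univ.filter (fun x' => blkOf D.toDomains x' = t), |T x x'| ≤ K (blkOf D.toDomains x) t := by
  -- the block test function: the sign pattern of the row on the block `t`
  set lam : ↥(boxDom (N0 ℓ Mh k P)) → ℝ :=
    fun x' => if blkOf D.toDomains x' = t then (SignType.sign (T x x') : ℝ) else 0 with hlam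
  have hsupp : BlockSupp (g := geomT D) (blkOf D.toDomains) lam t 1 := by
    refine ⟨zero_le_one, fun x' _ => ?_, fun x' hx' => by rw [hlam]; exact if_neg hx'⟩
    rw [hlam]; dsimp only
    split_ifs
    · rcases lt_trichotomy (T x x') 0 with hr | hr | hr
      · rw [sign_neg hr]; simp
      · rw [hr]; simp
      · rw [sign_pos hr]; simp
    · simp
  have hpair : ∑ x', T x x' * lam x' = ∑ x' ∈ Finset.univ.filter (fun x' => blkOf D.toDomains x' = t), |T x x'| := by
    rw [Finset.sum_filter]
    refine Finset.sum_congr rfl fun x' _ => ?_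
    rw [hlam]; dsimp only
    split_ifs with h
    · rcases lt_trichotomy (T x x') 0 with hr | hr | hr
      · rw [sign_neg hr, abs_of_neg hr]; simp
      · rw [hr]; simp
      · rw [sign_pos hr, abs_of_pos hr]; simp
    · rw [mul_zero]
  have h := hT t lam 1 hsupp x
  rw [Matrix.toLin'_apply, mul_one, Matrix.mulVec, dotProduct, hpair] at h
  exact (le_abs_self _).trans h

end RowMass

/-! ## §2. THE JUNCTION: a decaying block majorant on `geomT D` is a k-uniform block letter between top cubes -/

section Junction

variable {ℓ Mh k R : ℕ} {P : Fin (d + 1) → ℕ} {D : TDomains d ℓ Mh k P R}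
variable {Kc : Fin (d + 1) → ℕ} [∀ i, NeZero (Kc i)]

/-- **THE ROW FORM OF THE JUNCTION** (kept separate for WEIGHTED letters): under the hypotheses of `blockNorm_le_of_hasMajorant`
but WITHOUT the uniform bound `F ≤ F̄`, every row `x` with top cube `Y` has mass over the top cube `Y′` at most
`F(y(x))·c₁·e^{−(½δ/(d+1))·d₁(Y,Y′)}` — the level enters only through `F(y(x))`, so a row weight `ω(x)` with `ω(x)F(y(x))` uniform gives
a uniform letter (print's `(L^jη)^{−1}`, `(L^jη)^{−2}` weights of (3.61) against (3.42)'s `(L^jη)`, `(L^jη)²`).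
[cite: Balaban1984PropagatorsII, Prop. 2.2 (2.67) p.234, Lemma 2.1 (2.61) p.234; Balaban1985BackgroundPropagators, (3.42) p.397, (3.61) p.402] -/
theorem rowSum_le_of_hasMajorant (hMh : 1 ≤ Mh) (hP : ∀ μ, 1 ≤ P μ) (hKc : ∀ i, N0 ℓ Mh k P i = (ℓ + 1) ^ k * Kc i)
    (T : Matrix ↥(boxDom (N0 ℓ Mh k P)) ↥(boxDom (N0 ℓ Mh k P)) ℝ) {F : ↥(bset D.toDomains) → ℝ} {δ c₁ : ℝ}
    (hδ : 0 ≤ δ) (hF0 : ∀ y, 0 ≤ F y)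
    (hT : HasMajorant (g := geomT D) (blkOf D.toDomains) (Matrix.toLin' T)
      (fun y y' => F y * Real.exp (-(δ * (geomT D).dist y y'))))
    (h261 : Ineq261With c₁ (geomT D) δ (1 / 2)) (Y Y' : UT Kc) (x : ↥(boxDom (N0 ℓ Mh k P)))
    (hx : cubeML ℓ k Kc x.1 = Y) :
    ∑ x' ∈ Finset.univ.filter (fun x' : ↥(boxDom (N0 ℓ Mh k P)) => cubeML ℓ k Kc x'.1 = Y'), |T x x'| ≤
      F (blkOf D.toDomains x) * c₁ * Real.exp (-(δ / 2 / ((d : ℝ) + 1) * tdist1 Kc Y Y')) := by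
  set cub : ↥(boxDom (N0 ℓ Mh k P)) → UT Kc := fun x => cubeML ℓ k Kc x.1 with hcub
  set y := blkOf D.toDomains x with hy
  have hyY : topOf D.toDomains Kc y = Y := by rw [hy, topOf_blkOf]; exact hx
  -- the row mass over the top cube `Y′`, fibred along the blocks `t ⊂ Y′`
  have hmaps : ∀ x' ∈ Finset.univ.filter (fun x' => cub x' = Y'),
      blkOf D.toDomains x' ∈ Finset.univ.filter (fun t => topOf D.toDomains Kc t = Y') := by
    intro x' hx'
    simp only [Finset.mem_filter, Finset.mem_univ, true_and] at hx' ⊢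
    rw [topOf_blkOf]; exact hx'
  show ∑ x' ∈ Finset.univ.filter (fun x' => cub x' = Y'), |T x x'| ≤ _
  rw [← Finset.sum_fiberwise_of_maps_to hmaps]
  -- each fibre: the block mass, bounded by the majorant
  have hfib : ∀ t ∈ Finset.univ.filter (fun t => topOf D.toDomains Kc t = Y'),
      ∑ x' ∈ (Finset.univ.filter (fun x' => cub x' = Y')).filter (fun x' => blkOf D.toDomains x' = t), |T x x'|
        ≤ F y * Real.exp (-(δ / 2 * (geomT D).dist y t)) * Real.exp (-(δ / 2 / ((d : ℝ) + 1) * tdist1 Kc Y Y')) := by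
    intro t ht
    simp only [Finset.mem_filter, Finset.mem_univ, true_and] at ht
    calc ∑ x' ∈ (Finset.univ.filter (fun x' => cub x' = Y')).filter (fun x' => blkOf D.toDomains x' = t), |T x x'|
        ≤ ∑ x' ∈ Finset.univ.filter (fun x' => blkOf D.toDomains x' = t), |T x x'| := by
          refine Finset.sum_le_sum_of_subset_of_nonneg (fun x' hx' => ?_) fun _ _ _ => abs_nonneg _
          simp only [Finset.mem_filter, Finset.mem_univ, true_and] at hx' ⊢
          exact hx'.2
      _ ≤ F y * Real.exp (-(δ * (geomT D).dist y t)) := rowBlockMass_le_of_hasMajorant D T hT x t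
      _ = F y * Real.exp (-(δ / 2 * (geomT D).dist y t)) * Real.exp (-(δ / 2 * (geomT D).dist y t)) := by
          rw [mul_assoc, ← Real.exp_add]; congr 1; congr 1; ring
      _ ≤ F y * Real.exp (-(δ / 2 * (geomT D).dist y t)) * Real.exp (-(δ / 2 / ((d : ℝ) + 1) * tdist1 Kc Y Y')) := by
          refine mul_le_mul_of_nonneg_left ?_ (mul_nonneg (hF0 y) (Real.exp_pos _).le)
          have h := exp_neg_dist_le (D := D) (Kc := Kc) hMh hP hKc (δ := δ / 2) (by positivity) y t
          rw [hyY, ht] at h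
          exact h
  refine (Finset.sum_le_sum hfib).trans ?_
  rw [← Finset.sum_mul, ← Finset.mul_sum]
  -- (2.61): sum the half-rate factor over all blocks
  have hsum : ∑ t ∈ Finset.univ.filter (fun t => topOf D.toDomains Kc t = Y'), Real.exp (-(δ / 2 * (geomT D).dist y t))
      ≤ c₁ := by
    calc ∑ t ∈ Finset.univ.filter (fun t => topOf D.toDomains Kc t = Y'), Real.exp (-(δ / 2 * (geomT D).dist y t))
        ≤ ∑ t, Real.exp (-(δ / 2 * (geomT D).dist y t)) :=
          Finset.sum_le_sum_of_subset_of_nonneg (Finset.filter_subset _ _) fun _ _ _ => (Real.exp_pos _).le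
      _ = ∑ t, Real.exp (-(1 / 2 * δ * (geomT D).dist y t)) := Finset.sum_congr rfl fun t _ => by ring_nf
      _ ≤ c₁ := h261 y
  have hexp0 : 0 ≤ Real.exp (-(δ / 2 / ((d : ℝ) + 1) * tdist1 Kc Y Y')) := (Real.exp_pos _).le
  exact mul_le_mul_of_nonneg_right (mul_le_mul_of_nonneg_left hsum (hF0 y)) hexp0

/-- **THE MULTI-LEVEL JUNCTION.**  Let `T` have the block majorant `F(y)·e^{−δ·d_T(y,y′)}` on [4]'s multiscale geometry
`geomT D` (`δ ≥ 0`, `0 ≤ F ≤ F̄`), and let (2.61) hold at the rate `½δ` with constant `c₁ ≥ 0`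
(`Σ_{y′∈𝔅} e^{−½δ·d_T(y,y′)} ≤ c₁`).  Then between any two TOP cubes `Y, Y′` of the cube torus `UT Kc` (`N₀ = L^k·Kc`):
`‖T.map ofReal‖_{Y,Y′} ≤ F̄·c₁·e^{−(½δ/(d+1))·d₁(Y,Y′)}`.  The blocks inside `Y′` are SUMMED by (2.61) — no count `L^{(d+1)(k−j)}`,
so the letter is uniform in `k`, the torus and the family `{Ω_j}` whenever `F̄, c₁, δ` are.
[cite: Balaban1984PropagatorsII, Prop. 2.2 (2.67) p.234, Lemma 2.1 (2.61) p.234; Balaban1985BackgroundPropagators, Thm 3.10 (3.108) p.416] -/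
theorem blockNorm_le_of_hasMajorant (hMh : 1 ≤ Mh) (hP : ∀ μ, 1 ≤ P μ) (hKc : ∀ i, N0 ℓ Mh k P i = (ℓ + 1) ^ k * Kc i)
    (T : Matrix ↥(boxDom (N0 ℓ Mh k P)) ↥(boxDom (N0 ℓ Mh k P)) ℝ) {F : ↥(bset D.toDomains) → ℝ} {Fbar δ c₁ : ℝ}
    (hδ : 0 ≤ δ) (hFbar : 0 ≤ Fbar) (hc₁ : 0 ≤ c₁) (hF0 : ∀ y, 0 ≤ F y) (hF : ∀ y, F y ≤ Fbar)
    (hT : HasMajorant (g := geomT D) (blkOf D.toDomains) (Matrix.toLin' T)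
      (fun y y' => F y * Real.exp (-(δ * (geomT D).dist y y'))))
    (h261 : Ineq261With c₁ (geomT D) δ (1 / 2)) (Y Y' : UT Kc) :
    blockNorm (fun x : ↥(boxDom (N0 ℓ Mh k P)) => cubeML ℓ k Kc x.1) (fun x : ↥(boxDom (N0 ℓ Mh k P)) => cubeML ℓ k Kc x.1)
        (T.map ((↑) : ℝ → ℂ)) Y Y' ≤
      Fbar * c₁ * Real.exp (-(δ / 2 / ((d : ℝ) + 1) * tdist1 Kc Y Y')) := by
  refine blockNorm_map_ofReal_le _ _ T Y Y' (by positivity) fun x hx => ?_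
  refine (rowSum_le_of_hasMajorant (D := D) hMh hP hKc T hδ hF0 hT h261 Y Y' x hx).trans ?_
  exact mul_le_mul_of_nonneg_right (mul_le_mul_of_nonneg_right (hF _) hc₁) (Real.exp_pos _).le

end Junction

/-! ## §3. THE INSTANCE: the genuine multi-level flat propagator — value and derivative letters, k-uniformly -/

section Instance

/-- **THE FLAT LETTERS ON THE MULTI-LEVEL TORUS FAMILY — VALUE AND DERIVATIVE, UNIFORM IN `k`, THE TORUS AND THE FAMILY
`{Ω_j}`.**  There are `δ₁, C, M₀ > 0` and `N₀ ≥ 1` (functions of `d, ℓ` and the weight windows `[a₋,a₊]`, `[c₋,c₊]` ONLY) such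
that for EVERY number of levels `k`, `M_h ≥ 3` with `L·M_h ≥ M₀` («M sufficiently large»), `R ≥ 2L` with `R·M ≥ N₀ + 1` ((2.59)),
torus size `P` (`P_μ ≥ 4`), nested family `D` of domains of the torus ((2.1)–(2.2)), weights in the windows with
`a_{i+1} = aNext ℓ a_i c_i`, and every cube torus `UT Kc` of the top blocks (`N₀_μ = L^k·Kc_μ`): for ALL top cubes `Y, Y′`,
with `G′ = gmlT = Δ′_a^{−1}` and `∂_μ = dT μ` (unit forward difference; lattice units),
`‖G′.map ofReal‖_{Y,Y′} ≤ C·L^{2k}·e^{−δ₁d₁(Y,Y′)}` and `‖(∂_μG′).map ofReal‖_{Y,Y′} ≤ C·L^{k}·e^{−δ₁d₁(Y,Y′)}`.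
(Print's units, `η = L^{−k}`: `‖η²G′‖ ≤ Ce^{−δ₁d₁}`, `‖∇^η_μ(η²G′)‖ = ‖η∂_μG′‖ ≤ Ce^{−δ₁d₁}` — `flatLetters_multiLevelTorus_printUnits`.)
Inputs: `prop22_first_multiLevelTorus`, `prop22_second_multiLevelTorus` (hypothesis-free), `lemma21_torus` ((2.61) on the torus at
the rate `¼·min δ₀`), `blockNorm_le_of_hasMajorant`. [cite: Balaban1984PropagatorsII, Prop. 2.2 (2.67) p.234 (first and second entries), Lemma 2.1 (2.61) p.234, p.224; Balaban1985BackgroundPropagators, Thm 3.1 (3.42) p.397, p.399] -/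
theorem flatLetters_multiLevelTorus (d ℓ : ℕ) (hℓ : 1 ≤ ℓ) (aminus aplus a2minus a2plus : ℝ) (ha : 0 < aminus)
    (ha2 : 0 < a2minus) :
    ∃ δ₁ C M₀ : ℝ, ∃ N₀ : ℕ, 0 < δ₁ ∧ 0 < C ∧ 0 < M₀ ∧ 0 < N₀ ∧
      ∀ (k Mh R : ℕ), 3 ≤ Mh → M₀ ≤ ((ℓ : ℝ) + 1) * Mh → 2 * (ℓ + 1) ≤ R → N₀ + 1 ≤ R * ((ℓ + 1) * Mh) →
      ∀ (P : Fin (d + 1) → ℕ) (hP : ∀ μ, 1 ≤ P μ) (hP4 : ∀ μ, 4 ≤ P μ) (D : TDomains d ℓ Mh k P R) (a c : ℕ → ℝ),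
        (∀ i, 1 ≤ i → aminus ≤ a i ∧ a i ≤ aplus) → (∀ i, 1 ≤ i → a2minus ≤ c i ∧ c i ≤ a2plus) →
        (∀ i, 1 ≤ i → a (i + 1) = aNext ℓ (a i) (c i)) →
      ∀ (Kc : Fin (d + 1) → ℕ) [∀ i, NeZero (Kc i)], (∀ i, N0 ℓ Mh k P i = (ℓ + 1) ^ k * Kc i) →
      ∀ Y Y' : UT Kc,
        blockNorm (fun x : ↥(boxDom (N0 ℓ Mh k P)) => cubeML ℓ k Kc x.1)
            (fun x : ↥(boxDom (N0 ℓ Mh k P)) => cubeML ℓ k Kc x.1)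
            ((gmlT (N0 ℓ Mh k P) ℓ k D.lev a).map ((↑) : ℝ → ℂ)) Y Y' ≤
          C * ((ℓ : ℝ) + 1) ^ (2 * k) * Real.exp (-(δ₁ * tdist1 Kc Y Y')) ∧
        ∀ μ : Fin (d + 1),
          blockNorm (fun x : ↥(boxDom (N0 ℓ Mh k P)) => cubeML ℓ k Kc x.1)
              (fun x : ↥(boxDom (N0 ℓ Mh k P)) => cubeML ℓ k Kc x.1)
              ((dT (N0 ℓ Mh k P) μ * gmlT (N0 ℓ Mh k P) ℓ k D.lev a).map ((↑) : ℝ → ℂ)) Y Y' ≤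
            C * ((ℓ : ℝ) + 1) ^ k * Real.exp (-(δ₁ * tdist1 Kc Y Y')) := by
  obtain ⟨δa, Ca, Ma, Na, hδa, hCa, hMa, hNa, hA⟩ := prop22_first_multiLevelTorus d ℓ hℓ aminus aplus a2minus a2plus ha ha2
  obtain ⟨δb, Cb, Mb, Nb, hδb, hCb, hMb, hNb, hB⟩ :=
    prop22_second_multiLevelTorus d ℓ hℓ aminus aplus a2minus a2plus ha ha2
  have hL0 : (0 : ℝ) < (ℓ : ℝ) + 1 := by positivity
  have hL1 : (1 : ℝ) ≤ (ℓ : ℝ) + 1 := by linarith [(Nat.cast_nonneg ℓ : (0 : ℝ) ≤ ℓ)]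
  -- the common majorant rate `δ/2`, `δ = min δa δb`; (2.61) at the rate `δ/4` and its (2.59)-threshold `Nc`
  set δ : ℝ := min δa δb with hδ
  have hδpos : 0 < δ := lt_min hδa hδb
  set Nc : ℕ := ⌈4 * ((d : ℝ) + 1) * ((ℓ : ℝ) + 1) / (1 / 2 * (δ / 2))⌉₊ + 1 with hNc
  have hNcpos : 0 < Nc := by rw [hNc]; omega
  have hθlt : Real.exp (-(1 / 2 * (δ / 2))) * ((ℓ : ℝ) + 1) ^ ((2 * (d + 1 : ℕ) : ℝ) / Nc) < 1 := by
    refine theta_lt_one_of_log hL0 hNcpos ?_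
    have hlog : Real.log ((ℓ : ℝ) + 1) ≤ (ℓ : ℝ) + 1 := (Real.log_le_sub_one_of_pos hL0).trans (by linarith)
    have hNcge : 4 * ((d : ℝ) + 1) * ((ℓ : ℝ) + 1) / (1 / 2 * (δ / 2)) < (Nc : ℝ) := by
      rw [hNc]; push_cast
      exact lt_of_le_of_lt (Nat.le_ceil _) (by linarith)
    have hσ : (0 : ℝ) < 1 / 2 * (δ / 2) := by positivity
    rw [div_lt_iff₀ hσ] at hNcge
    push_cast
    nlinarith [mul_nonneg (by positivity : (0 : ℝ) ≤ 2 * ((d : ℝ) + 1)) (Real.log_nonneg hL1)]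
  set c₁ : ℝ := K261 Nc (d + 1) ((ℓ : ℝ) + 1) 1 (1 / 2 * (δ / 2)) with hc₁
  have hc₁0 : 0 ≤ c₁ := K261_nonneg (by positivity) zero_le_one
  refine ⟨δ / 2 / 2 / ((d : ℝ) + 1), max Ca Cb * c₁ + 1, max Ma Mb, max Na (max Nb Nc), by positivity, by positivity,
    lt_max_iff.2 (Or.inl hMa), lt_max_iff.2 (Or.inl hNa), ?_⟩
  intro k Mh R hMh hM hR hRM P hP hP4 D a c haw hcw hac Kc _ hKc Y Y'
  have hMh1 : 1 ≤ Mh := le_trans (by norm_num) hMh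
  have hMa' : Ma ≤ ((ℓ : ℝ) + 1) * Mh := (le_max_left _ _).trans hM
  have hMb' : Mb ≤ ((ℓ : ℝ) + 1) * Mh := (le_max_right _ _).trans hM
  have hN1 := Nat.le_max_left Na (max Nb Nc)
  have hN2 := Nat.le_max_right Na (max Nb Nc)
  have hN3 := Nat.le_max_left Nb Nc
  have hN4 := Nat.le_max_right Nb Nc
  have hNa' : Na + 1 ≤ R * ((ℓ + 1) * Mh) := by omega
  have hNb' : Nb + 1 ≤ R * ((ℓ + 1) * Mh) := by omega
  have hNc' : Nc + 1 ≤ R * ((ℓ + 1) * Mh) := by omega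
  -- (2.61) on the torus at the rate `δ/4`
  obtain ⟨-, h261, -, -⟩ := lemma21_torus D hMh1 hP hNcpos hNc' (δ₀ := δ / 2) (α := 1 / 2) (by positivity)
    (by norm_num) (by norm_num) hθlt
  have hdnn : ∀ y y' : (geomT D).Site, 0 ≤ (geomT D).dist y y' := (triangle_refl_nonneg_T D hMh1 hP).2.2
  have hrate : ∀ {δ' : ℝ}, δ ≤ δ' → ∀ y y' : (geomT D).Site,
      Real.exp (-(δ' / 2 * (geomT D).dist y y')) ≤ Real.exp (-(δ / 2 * (geomT D).dist y y')) := by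
    intro δ' hδ' y y'
    rw [Real.exp_le_exp, neg_le_neg_iff]
    exact mul_le_mul_of_nonneg_right (by linarith) (hdnn y y')
  have hlev : ∀ y : ↥(bset D.toDomains), y.1.1 ≤ k := fun y => (scale_bounds D.toDomains y).2
  have hexp0 : 0 ≤ Real.exp (-(δ / 2 / 2 / ((d : ℝ) + 1) * tdist1 Kc Y Y')) := (Real.exp_pos _).le
  refine ⟨?_, fun μ => ?_⟩
  · -- the value letter
    have hGmaj : HasMajorant (g := geomT D) (blkOf D.toDomains) (Matrix.toLin' (gmlT (N0 ℓ Mh k P) ℓ k D.lev a))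
        (fun y y' => (Ca * ((ℓ : ℝ) + 1) ^ (2 * y.1.1)) * Real.exp (-(δ / 2 * (geomT D).dist y y'))) :=
      hasMajorant_mono (blkOf D.toDomains) (hA k Mh R hMh hMa' hR hNa' P hP hP4 D a c haw hcw hac) fun y y' =>
        mul_le_mul_of_nonneg_left (hrate (min_le_left _ _) y y') (by positivity)
    have h := blockNorm_le_of_hasMajorant (D := D) (Kc := Kc) hMh1 hP hKc (gmlT (N0 ℓ Mh k P) ℓ k D.lev a)
      (F := fun y => Ca * ((ℓ : ℝ) + 1) ^ (2 * y.1.1)) (Fbar := Ca * ((ℓ : ℝ) + 1) ^ (2 * k)) (δ := δ / 2) (c₁ := c₁)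
      (by positivity) (by positivity) hc₁0 (fun y => by positivity)
      (fun y => mul_le_mul_of_nonneg_left (pow_le_pow_right₀ hL1 (by have := hlev y; omega)) hCa.le) hGmaj h261 Y Y'
    refine h.trans ?_
    have hconst : Ca * ((ℓ : ℝ) + 1) ^ (2 * k) * c₁ ≤ (max Ca Cb * c₁ + 1) * ((ℓ : ℝ) + 1) ^ (2 * k) := by
      have h1 : Ca * c₁ ≤ max Ca Cb * c₁ + 1 := by nlinarith [le_max_left Ca Cb]
      have h2 : (0 : ℝ) ≤ ((ℓ : ℝ) + 1) ^ (2 * k) := by positivity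
      nlinarith
    exact mul_le_mul_of_nonneg_right hconst hexp0
  · -- the derivative letter
    have hDmaj : HasMajorant (g := geomT D) (blkOf D.toDomains)
        (Matrix.toLin' (dT (N0 ℓ Mh k P) μ * gmlT (N0 ℓ Mh k P) ℓ k D.lev a))
        (fun y y' => (Cb * ((ℓ : ℝ) + 1) ^ y.1.1) * Real.exp (-(δ / 2 * (geomT D).dist y y'))) :=
      hasMajorant_mono (blkOf D.toDomains) (hB k Mh R hMh hMb' hR hNb' P hP hP4 D a c haw hcw hac μ) fun y y' =>
        mul_le_mul_of_nonneg_left (hrate (min_le_right _ _) y y') (by positivity)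
    have h := blockNorm_le_of_hasMajorant (D := D) (Kc := Kc) hMh1 hP hKc
      (dT (N0 ℓ Mh k P) μ * gmlT (N0 ℓ Mh k P) ℓ k D.lev a)
      (F := fun y => Cb * ((ℓ : ℝ) + 1) ^ y.1.1) (Fbar := Cb * ((ℓ : ℝ) + 1) ^ k) (δ := δ / 2) (c₁ := c₁)
      (by positivity) (by positivity) hc₁0 (fun y => by positivity)
      (fun y => mul_le_mul_of_nonneg_left (pow_le_pow_right₀ hL1 (hlev y)) hCb.le) hDmaj h261 Y Y'
    refine h.trans ?_
    have hconst : Cb * ((ℓ : ℝ) + 1) ^ k * c₁ ≤ (max Ca Cb * c₁ + 1) * ((ℓ : ℝ) + 1) ^ k := by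
      have h1 : Cb * c₁ ≤ max Ca Cb * c₁ + 1 := by nlinarith [le_max_right Ca Cb]
      have h2 : (0 : ℝ) ≤ ((ℓ : ℝ) + 1) ^ k := by positivity
      nlinarith
    exact mul_le_mul_of_nonneg_right hconst hexp0

end Instance

end Summit.QuantumFields.BalabanUV.Gaps.D4WalkBlockFlatLettersMultiLevel

end
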